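import Mathlib.AlgebraicGeometry.Morphisms.OpenImmersion
import Mathlib.RingTheory.RegularLocalRing.Defs
import Literature.AlgebraicGeometry.Resolution.QuasiExcellentSchemes
import HarnessLib

/-!
# Open immersions identify regular loci (crux `FrobeniusLadder.FRationalResolution`, line `Sketch`)

Stub `preimage_regularLocus_of_isOpenImmersion` of the skeleton `Sketch` for crux
stmt-ResolutionOfSingularities-15317 (wave 13, Zariski-local recognition). For an open `U ⊆ X`
and an open immersion `j : U → Y`, the preimage under `j` of the regular locus of `Y` and the
preimage under `U.ι` of the regular locus of `X` are the same open of `U`: at a point `u : U`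
both membership conditions say that the local ring `𝒪_{U,u}` is regular, because the stalk
maps `𝒪_{Y, j u} ⟶ 𝒪_{U,u}` and `𝒪_{X, u.1} ⟶ 𝒪_{U,u}` of the open immersions `j` and `U.ι`
are isomorphisms (Mathlib instance `IsIso (f.stalkMap x)` for open immersions), and regularity
of a local ring is transported along ring isomorphisms (`IsRegularLocalRing.of_ringEquiv`).
-/

set_option linter.dupNamespace false

noncomputable section

open CategoryTheory AlgebraicGeometry TopologicalSpace
open Literature.AlgebraicGeometry.Resolution

namespace Summit.ResolutionOfSingularities.ResolutionOfSingularities.Theorems.FRationalResolution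

/-- **Open immersions identify regular loci.** For an open `U ⊆ X` and an open immersion
`j : U → Y`, `j⁻¹(Reg Y) = U.ι⁻¹(Reg X)` as opens of `U`: both consist of the points of `U`
with regular local ring, the stalk maps of the open immersions `j` and `U.ι` being
isomorphisms. -/
theorem preimage_regularLocus_of_isOpenImmersion {X Y : Scheme.{0}} (U : X.Opens)
    (j : (U : Scheme.{0}) ⟶ Y) [IsOpenImmersion j] (hX : IsOpen (Scheme.regularLocus X))
    (hY : IsOpen (Scheme.regularLocus Y)) :
    j ⁻¹ᵁ ⟨Scheme.regularLocus Y, hY⟩ = U.ι ⁻¹ᵁ ⟨Scheme.regularLocus X, hX⟩ := by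
  ext u
  change j.base u ∈ Scheme.regularLocus Y ↔ U.ι.base u ∈ Scheme.regularLocus X
  simp only [Scheme.mem_regularLocus]
  -- the stalk maps of the open immersions `j` and `U.ι` at `u` are isomorphisms
  let eY : Y.presheaf.stalk (j.base u) ≃+* (U : Scheme.{0}).presheaf.stalk u :=
    (asIso (j.stalkMap u)).commRingCatIsoToRingEquiv
  let eX : X.presheaf.stalk (U.ι.base u) ≃+* (U : Scheme.{0}).presheaf.stalk u :=
    (asIso (U.ι.stalkMap u)).commRingCatIsoToRingEquiv
  constructor
  · intro h
    haveI : IsRegularLocalRing ((U : Scheme.{0}).presheaf.stalk u) :=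
      IsRegularLocalRing.of_ringEquiv eY
    exact IsRegularLocalRing.of_ringEquiv eX.symm
  · intro h
    haveI : IsRegularLocalRing ((U : Scheme.{0}).presheaf.stalk u) :=
      IsRegularLocalRing.of_ringEquiv eX
    exact IsRegularLocalRing.of_ringEquiv eY.symm

end Summit.ResolutionOfSingularities.ResolutionOfSingularities.Theorems.FRationalResolution

end
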